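import Summits.CriticalPhenomena.PercolationContinuityZ3.Theorems.PercNearOneGluingNoHeavyLowerTailThreePartitionOneOrTwistedCertBase
import Summits.CriticalPhenomena.PercolationContinuityZ3.Theorems.PercNearOneGluingNoHeavyLowerTailThreePartitionOneOrHeart
import HarnessLib.Audit

/-!
# `NoHeavyLowerTail` (crux stmt-CriticalPhenomena-4575), master-family hierarchy P3 (gen 38): the TWISTED K* IS A CERTIFICATE — a pure diagonal certificate for
# the disjunction junta `OR_Q` at EVERY twist, hence (with `DiagCert.andVar`) COMB-C3 for `(OR_Q ∧ AND_J, A, B)` for ALL blocks `Q`, coin sets `J`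

Support file (seat `prim-masterthm-p3`; `--supports stmt-CriticalPhenomena-4575`; memo
`run/shared/lean/prim/prim-masterthm/FROM-prim-masterthm-p3-g38-PDC-STRUCTURE.md` §5bis).  With `T = τ ∩ Q ≠ ∅` and `x₀ ∈ T`, the weights
`orKappa τ Q x₀` (file `…OneOrTwistedCertBase`) satisfy condition (i): for all up-set signatures `𝔄, 𝔅`,
`Σ_P cJ(P)[qc₂P ∈ 𝔄][qc₃P ∈ 𝔅] ≤ Σ_m κ(m)[m ∈ 𝔄 ∩ 𝔅]`.  PROOF (the twisted (♥)): block-level relabelling symmetries (`sum_cfgsIn_ind₃_swap12/13/23`, from the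
junta scaling of `…JuntaBlockKleitman`) settle the degenerate signatures `𝔄 = ⊤` or `𝔅 = ⊤`; for generic signatures (`∅ ∉ 𝔄 ∪ 𝔅`) the slack is
`Σ_{u ⊆ Q} (1 + [u = T])·klCube 𝔅ᵤ 𝔄ᵤ (Q∖u) − #{P : qc₃P = ∅}·[{x₀} ∈ 𝔄 ∩ 𝔅]` (fibre identity of the base file), every `klCube` is `≥ 0` (`klCube_nonneg`), and when
`{x₀} ∈ 𝔄 ∩ 𝔅` each of the `#{u ⊆ Q : T ⊆ Q∖u} = #{P : qc₃P = ∅}` fibres avoiding `T` has `klCube ≥ 1` (`one_le_klCube`).  THEOREM `diagCert_orKappa`: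
`DiagCert τ Q nonemptyFam (orKappa τ Q x₀)`.  With gen 37's untwisted `K*` repackaged (`diagCert_or_untwisted`: `wPat_le_kStar`, `kStar_le_phiPat`) every twist of the
block carries a certificate (`exists_diagCert_or`), so by `exists_diagCert_andVars` / `liftQ_union_andVars`:
**`threePartNT_orFam_and_nonneg`: `0 ≤ N_τ(orFam Q ∩ {S : J ⊆ S}; A, B)` for ALL finite disjoint `Q, J`, ALL up-sets `A, B`, EVERY twist `τ`** —
a disjunction of any number of coins AND-ed with any number of further coins against two ARBITRARY increasing events (the first all-`k` kernel class mixing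
`∨` and `∧`).  HONEST LABEL: the general conjecture (COMB-C3) stays OPEN; nothing here bears on the closed crux. [this work]
-/

noncomputable section

open Finset
open scoped symmDiff Classical

namespace Summit.CriticalPhenomena.PercolationContinuityZ3.Theorems.ThreePartition

variable {ι : Type*} [Fintype ι]

/-! ## Block-level relabelling symmetries -/

section Swap

variable (τ Q : Set ι) (𝔛 𝔜 ℨ : Set (Set ι))

/-- Parts 1 ↔ 3. [this work] -/
theorem sum_cfgsIn_ind₃_swap13 :
    ∑ P ∈ cfgsIn Q, indZ (qc₁ τ Q P ∈ 𝔛 ∧ qc₂ τ Q P ∈ 𝔜 ∧ qc₃ τ Q P ∈ ℨ) = ∑ P ∈ cfgsIn Q, indZ (qc₁ τ Q P ∈ ℨ ∧ qc₂ τ Q P ∈ 𝔜 ∧ qc₃ τ Q P ∈ 𝔛) := by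
  have hn := nRep_pos τ Q
  have h := sum_cfgsIn_ind₃_mul_nRep τ Q 𝔛 𝔜 ℨ
  have h' := sum_cfgsIn_ind₃_mul_nRep τ Q ℨ 𝔜 𝔛
  rw [triT_swap13] at h'
  have e : (∑ P ∈ cfgsIn Q, indZ (qc₁ τ Q P ∈ 𝔛 ∧ qc₂ τ Q P ∈ 𝔜 ∧ qc₃ τ Q P ∈ ℨ)) * nRep τ Q
      = (∑ P ∈ cfgsIn Q, indZ (qc₁ τ Q P ∈ ℨ ∧ qc₂ τ Q P ∈ 𝔜 ∧ qc₃ τ Q P ∈ 𝔛)) * nRep τ Q := by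
    rw [h, h']; exact_mod_cast triT_congr fun a b c => by tauto
  exact mul_right_cancel₀ hn.ne' e

/-- Parts 2 ↔ 3. [this work] -/
theorem sum_cfgsIn_ind₃_swap23 :
    ∑ P ∈ cfgsIn Q, indZ (qc₁ τ Q P ∈ 𝔛 ∧ qc₂ τ Q P ∈ 𝔜 ∧ qc₃ τ Q P ∈ ℨ) = ∑ P ∈ cfgsIn Q, indZ (qc₁ τ Q P ∈ 𝔛 ∧ qc₂ τ Q P ∈ ℨ ∧ qc₃ τ Q P ∈ 𝔜) := by
  have hn := nRep_pos τ Q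
  have h := sum_cfgsIn_ind₃_mul_nRep τ Q 𝔛 𝔜 ℨ
  have h' := sum_cfgsIn_ind₃_mul_nRep τ Q 𝔛 ℨ 𝔜
  rw [triT_swap23] at h'
  have e : (∑ P ∈ cfgsIn Q, indZ (qc₁ τ Q P ∈ 𝔛 ∧ qc₂ τ Q P ∈ 𝔜 ∧ qc₃ τ Q P ∈ ℨ)) * nRep τ Q
      = (∑ P ∈ cfgsIn Q, indZ (qc₁ τ Q P ∈ 𝔛 ∧ qc₂ τ Q P ∈ ℨ ∧ qc₃ τ Q P ∈ 𝔜)) * nRep τ Q := by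
    rw [h, h']; exact_mod_cast triT_congr fun a b c => by tauto
  exact mul_right_cancel₀ hn.ne' e

/-- Parts 1 ↔ 2. [this work] -/
theorem sum_cfgsIn_ind₃_swap12 :
    ∑ P ∈ cfgsIn Q, indZ (qc₁ τ Q P ∈ 𝔛 ∧ qc₂ τ Q P ∈ 𝔜 ∧ qc₃ τ Q P ∈ ℨ) = ∑ P ∈ cfgsIn Q, indZ (qc₁ τ Q P ∈ 𝔜 ∧ qc₂ τ Q P ∈ 𝔛 ∧ qc₃ τ Q P ∈ ℨ) := by
  have hn := nRep_pos τ Q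
  have h := sum_cfgsIn_ind₃_mul_nRep τ Q 𝔛 𝔜 ℨ
  have h' := sum_cfgsIn_ind₃_mul_nRep τ Q 𝔜 𝔛 ℨ
  rw [triT_swap12] at h'
  have e : (∑ P ∈ cfgsIn Q, indZ (qc₁ τ Q P ∈ 𝔛 ∧ qc₂ τ Q P ∈ 𝔜 ∧ qc₃ τ Q P ∈ ℨ)) * nRep τ Q
      = (∑ P ∈ cfgsIn Q, indZ (qc₁ τ Q P ∈ 𝔜 ∧ qc₂ τ Q P ∈ 𝔛 ∧ qc₃ τ Q P ∈ ℨ)) * nRep τ Q := by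
    rw [h, h']; exact_mod_cast triT_congr fun a b c => by tauto
  exact mul_right_cancel₀ hn.ne' e

end Swap

/-! ## Condition (i) for the twisted K* -/

section TwoLe

variable {τ Q : Set ι} {x₀ : ι}

omit [Fintype ι] in
/-- An up-set containing `∅` is everything. [folklore] -/
theorem eq_univ_of_empty_mem' {𝔄 : Set (Set ι)} (h𝔄 : IsUpperSet 𝔄) (h : (∅ : Set ι) ∈ 𝔄) : 𝔄 = Set.univ :=
  Set.eq_univ_of_forall fun x => h𝔄 (Set.empty_subset x) h

/-- If one twisted part is empty the others are not (`τ ∩ Q ≠ ∅`). [this work] -/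
theorem qc₁_nonempty_of_qc₃_empty (hT : (τ ∩ Q).Nonempty) {P : Set ι × Set ι} (hP : P ∈ cfgsIn Q) (h : qc₃ τ Q P = ∅) :
    (qc₁ τ Q P).Nonempty := by
  obtain ⟨t, ht⟩ := hT
  have hP' := mem_cfgsIn.1 hP
  -- `qc₃ = ∅` means `pt₃ = τ ∩ Q`, so `t ∈ pt₃`, `t ∉ P.1`, hence `t ∈ qc₁ = P.1 ∆ (τ∩Q)`
  have h3 : pt₃ Q P = τ ∩ Q := symmDiff_eq_bot.1 h
  have htp : t ∈ pt₃ Q P := h3 ▸ ht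
  refine ⟨t, ?_⟩
  rw [mem_qc₁_iff]
  exact Or.inr ⟨⟨ht.1, ht.2⟩, fun h1 => htp.2 (Or.inl h1)⟩

/-- The number of negative one-copy tokens `#{P : qc₃P = ∅}` is the number of subsets of `Q \ (τ ∩ Q)`. [this work] -/
theorem sum_indZ_qc₃_empty_eq_card (τ Q : Set ι) :
    ∑ P ∈ cfgsIn Q, indZ (qc₃ τ Q P = ∅) = ((subsetsOf (Q \ (τ ∩ Q))).card : ℤ) := by
  rw [sum_indZ_qc₃_eq, show (∅ : Set ι) ∆ (τ ∩ Q) = τ ∩ Q from bot_symmDiff _]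
  have e : ∑ u ∈ subsetsOf Q, indZ (τ ∩ Q ⊆ Q \ u) = ∑ u ∈ subsetsOf Q, (if u ∈ subsetsOf (Q \ (τ ∩ Q)) then (1 : ℤ) else 0) := by
    refine sum_congr rfl fun u hu => ?_
    rw [mem_subsetsOf] at hu
    unfold indZ
    congr 1
    simp only [mem_subsetsOf, eq_iff_iff]
    constructor
    · intro h c hc; exact ⟨hu hc, fun hcT => (h hcT).2 hc⟩
    · intro h c hcT; exact ⟨hcT.2, fun hcu => (h hcu).2 hcT⟩
  have hf : (subsetsOf Q).filter (fun u => u ∈ subsetsOf (Q \ (τ ∩ Q))) = subsetsOf (Q \ (τ ∩ Q)) := by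
    ext u; simp only [mem_filter, mem_subsetsOf, and_iff_right_iff_imp]
    exact fun h => h.trans Set.sdiff_subset
  rw [e, ← sum_filter, hf, sum_const, nsmul_eq_mul, mul_one]

/-- **The degenerate signature case** (`𝔇` an up-set, `x₀ ∈ τ ∩ Q ≠ ∅`): `Σ_P [qc₃P ∈ 𝔇 ∩ 𝔘] ≤ Σ_P eJ(P)[mergeEmptyAt x₀ (qc₃P) ∈ 𝔇]`. [this work] -/
theorem sum_ind_le_sum_eJ_merge (hx₀ : x₀ ∈ τ ∩ Q) {𝔇 : Set (Set ι)} (h𝔇 : IsUpperSet 𝔇) :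
    ∑ P ∈ cfgsIn Q, indZ (qc₁ τ Q P ∈ (Set.univ : Set (Set ι)) ∧ qc₂ τ Q P ∈ (Set.univ : Set (Set ι)) ∧ qc₃ τ Q P ∈ 𝔇 ∩ nonemptyFam)
      ≤ ∑ P ∈ cfgsIn Q, eJ τ Q nonemptyFam P * indZ (mergeEmptyAt x₀ (qc₃ τ Q P) ∈ 𝔇) := by
  have hT : (τ ∩ Q).Nonempty := ⟨x₀, hx₀⟩
  set c : ℤ := indZ (({x₀} : Set ι) ∈ 𝔇) with hc
  -- pointwise expansion of the right-hand side
  have erhs : ∀ P ∈ cfgsIn Q, eJ τ Q nonemptyFam P * indZ (mergeEmptyAt x₀ (qc₃ τ Q P) ∈ 𝔇)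
      = 2 * indZ (qc₁ τ Q P ∈ (Set.univ : Set (Set ι)) ∧ qc₂ τ Q P ∈ (Set.univ : Set (Set ι)) ∧ qc₃ τ Q P ∈ 𝔇 ∩ nonemptyFam)
        - indZ (qc₁ τ Q P ∈ (nonemptyFam : Set (Set ι)) ∧ qc₂ τ Q P ∈ (Set.univ : Set (Set ι)) ∧ qc₃ τ Q P ∈ 𝔇 ∩ nonemptyFam)
        - indZ (qc₃ τ Q P = ∅) * c := by
    intro P hP
    unfold eJ
    by_cases h0 : qc₃ τ Q P = ∅
    · have hne := qc₁_nonempty_of_qc₃_empty hT hP h0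
      rw [h0, mergeEmptyAt_empty, indZ_of_pos rfl, one_mul, indZ_of_pos (p := qc₁ τ Q P ∈ (nonemptyFam : Set (Set ι))) hne,
        indZ_of_neg (p := (∅ : Set ι) ∈ (nonemptyFam : Set (Set ι))) Set.not_nonempty_empty,
        indZ_of_neg (fun h : qc₁ τ Q P ∈ (Set.univ : Set (Set ι)) ∧ qc₂ τ Q P ∈ (Set.univ : Set (Set ι)) ∧ (∅ : Set ι) ∈ 𝔇 ∩ nonemptyFam =>
          Set.not_nonempty_empty h.2.2.2),
        indZ_of_neg (fun h : qc₁ τ Q P ∈ (nonemptyFam : Set (Set ι)) ∧ qc₂ τ Q P ∈ (Set.univ : Set (Set ι)) ∧ (∅ : Set ι) ∈ 𝔇 ∩ nonemptyFam =>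
          Set.not_nonempty_empty h.2.2.2)]
      ring
    · have hne : qc₃ τ Q P ∈ (nonemptyFam : Set (Set ι)) := Set.nonempty_iff_ne_empty.2 h0
      rw [mergeEmptyAt_of_ne x₀ h0, indZ_of_pos hne, indZ_of_neg h0, zero_mul, sub_zero]
      by_cases hD : qc₃ τ Q P ∈ 𝔇
      · rw [indZ_of_pos hD, indZ_of_pos (⟨Set.mem_univ _, Set.mem_univ _, hD, hne⟩ : qc₁ τ Q P ∈ (Set.univ : Set (Set ι)) ∧ _ ∧ _)]
        by_cases h1 : qc₁ τ Q P ∈ (nonemptyFam : Set (Set ι))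
        · rw [indZ_of_pos h1, indZ_of_pos (⟨h1, Set.mem_univ _, hD, hne⟩ : _ ∧ qc₂ τ Q P ∈ (Set.univ : Set (Set ι)) ∧ _)]; ring
        · rw [indZ_of_neg h1, indZ_of_neg (fun h : qc₁ τ Q P ∈ (nonemptyFam : Set (Set ι)) ∧ _ => h1 h.1)]; ring
      · rw [indZ_of_neg hD, indZ_of_neg (fun h : _ ∧ _ ∧ qc₃ τ Q P ∈ 𝔇 ∩ nonemptyFam => hD h.2.2.1),
          indZ_of_neg (fun h : _ ∧ _ ∧ qc₃ τ Q P ∈ 𝔇 ∩ nonemptyFam => hD h.2.2.1)]; ring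
  rw [sum_congr rfl erhs, sum_sub_distrib, sum_sub_distrib, ← mul_sum, ← sum_mul, sum_indZ_qc₃_empty_eq_card]
  -- the difference of the first two sums counts the patterns with `qc₁ = ∅`, i.e. the fibre `P₁ = τ ∩ Q`
  have hdiff : ∑ P ∈ cfgsIn Q, indZ (qc₁ τ Q P ∈ (Set.univ : Set (Set ι)) ∧ qc₂ τ Q P ∈ (Set.univ : Set (Set ι)) ∧ qc₃ τ Q P ∈ 𝔇 ∩ nonemptyFam)
      - ∑ P ∈ cfgsIn Q, indZ (qc₁ τ Q P ∈ (nonemptyFam : Set (Set ι)) ∧ qc₂ τ Q P ∈ (Set.univ : Set (Set ι)) ∧ qc₃ τ Q P ∈ 𝔇 ∩ nonemptyFam)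
      = ∑ P ∈ cfgsIn Q, indZ (qc₁ τ Q P = ∅ ∧ qc₃ τ Q P ∈ 𝔇 ∩ nonemptyFam) := by
    rw [← sum_sub_distrib]
    refine sum_congr rfl fun P _ => ?_
    by_cases h1 : qc₁ τ Q P = ∅
    · rw [indZ_of_neg (fun h : qc₁ τ Q P ∈ (nonemptyFam : Set (Set ι)) ∧ _ => by rw [h1] at h; exact Set.not_nonempty_empty h.1), sub_zero]
      exact indZ_congr ⟨fun h => ⟨h1, h.2.2⟩, fun h => ⟨Set.mem_univ _, Set.mem_univ _, h.2⟩⟩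
    · have hne : qc₁ τ Q P ∈ (nonemptyFam : Set (Set ι)) := Set.nonempty_iff_ne_empty.2 h1
      rw [indZ_congr (show (qc₁ τ Q P ∈ (nonemptyFam : Set (Set ι)) ∧ qc₂ τ Q P ∈ (Set.univ : Set (Set ι)) ∧ qc₃ τ Q P ∈ 𝔇 ∩ nonemptyFam)
          ↔ (qc₁ τ Q P ∈ (Set.univ : Set (Set ι)) ∧ qc₂ τ Q P ∈ (Set.univ : Set (Set ι)) ∧ qc₃ τ Q P ∈ 𝔇 ∩ nonemptyFam) from
          ⟨fun h => ⟨Set.mem_univ _, h.2⟩, fun h => ⟨hne, h.2⟩⟩), sub_self, indZ_of_neg (fun h : qc₁ τ Q P = ∅ ∧ _ => h1 h.1)]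
  -- and that fibre count is at least `c · #subsetsOf (Q \ T)`
  have hfib : ((subsetsOf (Q \ (τ ∩ Q))).card : ℤ) * c ≤ ∑ P ∈ cfgsIn Q, indZ (qc₁ τ Q P = ∅ ∧ qc₃ τ Q P ∈ 𝔇 ∩ nonemptyFam) := by
    by_cases hxD : ({x₀} : Set ι) ∈ 𝔇
    · rw [hc, indZ_of_pos hxD, mul_one, sum_cfgsIn_eq_patSum]
      unfold patSum
      have hTQ : τ ∩ Q ∈ subsetsOf Q := mem_subsetsOf.2 Set.inter_subset_right
      rw [← add_sum_erase _ _ hTQ]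
      have hrest : 0 ≤ ∑ u ∈ (subsetsOf Q).erase (τ ∩ Q), ∑ a ∈ subsetsOf (Q \ u), indZ (qc₁ τ Q (u, (Q \ u) \ a) = ∅ ∧ qc₃ τ Q (u, (Q \ u) \ a) ∈ 𝔇 ∩ nonemptyFam) :=
        sum_nonneg fun _ _ => sum_nonneg fun _ _ => indZ_nonneg _
      have hmain : ((subsetsOf (Q \ (τ ∩ Q))).card : ℤ) ≤ ∑ a ∈ subsetsOf (Q \ (τ ∩ Q)), indZ (qc₁ τ Q (τ ∩ Q, (Q \ (τ ∩ Q)) \ a) = ∅ ∧ qc₃ τ Q (τ ∩ Q, (Q \ (τ ∩ Q)) \ a) ∈ 𝔇 ∩ nonemptyFam) := by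
        have : ∑ _a ∈ subsetsOf (Q \ (τ ∩ Q)), (1 : ℤ) = (subsetsOf (Q \ (τ ∩ Q))).card := by simp
        rw [← this]
        refine sum_le_sum fun a ha => ?_
        rw [mem_subsetsOf] at ha
        have e1 : qc₁ τ Q (τ ∩ Q, (Q \ (τ ∩ Q)) \ a) = ∅ := by unfold qc₁; exact symmDiff_self _
        have e3 : qc₃ τ Q (τ ∩ Q, (Q \ (τ ∩ Q)) \ a) = a ∪ (τ ∩ Q) := by
          unfold qc₃; rw [pt₃_mk ha]
          ext y; simp only [Set.mem_symmDiff, Set.mem_union]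
          constructor
          · rintro (⟨h, _⟩ | ⟨h, _⟩); exacts [Or.inl h, Or.inr h]
          · rintro (h | h)
            · exact Or.inl ⟨h, fun hT' => (ha h).2 hT'⟩
            · exact Or.inr ⟨h, fun ha' => (ha ha').2 h⟩
        have hmem : qc₃ τ Q (τ ∩ Q, (Q \ (τ ∩ Q)) \ a) ∈ 𝔇 ∩ nonemptyFam := by
          rw [e3]
          exact ⟨h𝔇 (by intro y hy; rw [Set.mem_singleton_iff.1 hy]; exact Or.inr hx₀) hxD, ⟨x₀, Or.inr hx₀⟩⟩
        rw [indZ_of_pos ⟨e1, hmem⟩]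
      linarith
    · rw [hc, indZ_of_neg hxD, mul_zero]; exact sum_nonneg fun _ _ => indZ_nonneg _
  -- symmetry 2 ↔ 3 is not needed here; assemble
  linarith [hdiff, hfib]

/-- **Condition (i) for the twisted K*** (`x₀ ∈ τ ∩ Q`). [this work] -/
theorem orKappa_two_le (hx₀ : x₀ ∈ τ ∩ Q) {𝔄 𝔅 : Set (Set ι)} (h𝔄 : IsUpperSet 𝔄) (h𝔅 : IsUpperSet 𝔅) :
    ∑ P ∈ cfgsIn Q, cJ τ Q nonemptyFam P * indZ (qc₂ τ Q P ∈ 𝔄 ∧ qc₃ τ Q P ∈ 𝔅)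
      ≤ ∑ m ∈ subsetsOf Q, orKappa τ Q x₀ m * indZ (m ∈ 𝔄 ∧ m ∈ 𝔅) := by
  have hT : (τ ∩ Q).Nonempty := ⟨x₀, hx₀⟩
  have hx₀Q : x₀ ∈ Q := hx₀.2
  rw [sum_orKappa_mul_indZ τ Q x₀ hx₀Q]
  by_cases h0B : (∅ : Set ι) ∈ 𝔅
  · -- 𝔅 = ⊤
    rw [eq_univ_of_empty_mem' h𝔅 h0B]
    have elhs : ∑ P ∈ cfgsIn Q, cJ τ Q nonemptyFam P * indZ (qc₂ τ Q P ∈ 𝔄 ∧ qc₃ τ Q P ∈ (Set.univ : Set (Set ι)))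
        = ∑ P ∈ cfgsIn Q, indZ (qc₁ τ Q P ∈ (Set.univ : Set (Set ι)) ∧ qc₂ τ Q P ∈ 𝔄 ∩ nonemptyFam ∧ qc₃ τ Q P ∈ (Set.univ : Set (Set ι)))
          + ∑ P ∈ cfgsIn Q, indZ (qc₁ τ Q P ∈ (Set.univ : Set (Set ι)) ∧ qc₂ τ Q P ∈ 𝔄 ∧ qc₃ τ Q P ∈ (nonemptyFam : Set (Set ι)))
          - ∑ P ∈ cfgsIn Q, indZ (qc₁ τ Q P ∈ (nonemptyFam : Set (Set ι)) ∧ qc₂ τ Q P ∈ 𝔄 ∧ qc₃ τ Q P ∈ (Set.univ : Set (Set ι))) := by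
      rw [← sum_add_distrib, ← sum_sub_distrib]
      refine sum_congr rfl fun P _ => ?_
      unfold cJ
      rw [sub_mul, add_mul, ← indZ_and, ← indZ_and, ← indZ_and]
      congr 2
      · exact indZ_congr ⟨fun h => ⟨Set.mem_univ _, ⟨h.2.1, h.1⟩, Set.mem_univ _⟩, fun h => ⟨h.2.1.2, h.2.1.1, Set.mem_univ _⟩⟩
      · exact indZ_congr ⟨fun h => ⟨Set.mem_univ _, h.2.1, h.1⟩, fun h => ⟨h.2.2, h.2.1, Set.mem_univ _⟩⟩
    rw [elhs, sum_cfgsIn_ind₃_swap13 τ Q (Set.univ : Set (Set ι)) 𝔄 nonemptyFam, add_sub_cancel_right,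
      sum_cfgsIn_ind₃_swap23 τ Q (Set.univ : Set (Set ι)) (𝔄 ∩ nonemptyFam) (Set.univ : Set (Set ι))]
    have e2 : ∑ P ∈ cfgsIn Q, eJ τ Q nonemptyFam P * indZ (mergeEmptyAt x₀ (qc₃ τ Q P) ∈ 𝔄 ∧ mergeEmptyAt x₀ (qc₃ τ Q P) ∈ (Set.univ : Set (Set ι)))
        = ∑ P ∈ cfgsIn Q, eJ τ Q nonemptyFam P * indZ (mergeEmptyAt x₀ (qc₃ τ Q P) ∈ 𝔄) :=
      sum_congr rfl fun P _ => by rw [indZ_congr (and_iff_left (Set.mem_univ _))]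
    rw [e2]; exact sum_ind_le_sum_eJ_merge (Q := Q) hx₀ h𝔄
  by_cases h0A : (∅ : Set ι) ∈ 𝔄
  · -- 𝔄 = ⊤, 𝔅 generic (or not — the argument does not care)
    rw [eq_univ_of_empty_mem' h𝔄 h0A]
    have elhs : ∑ P ∈ cfgsIn Q, cJ τ Q nonemptyFam P * indZ (qc₂ τ Q P ∈ (Set.univ : Set (Set ι)) ∧ qc₃ τ Q P ∈ 𝔅)
        = ∑ P ∈ cfgsIn Q, indZ (qc₁ τ Q P ∈ (Set.univ : Set (Set ι)) ∧ qc₂ τ Q P ∈ (nonemptyFam : Set (Set ι)) ∧ qc₃ τ Q P ∈ 𝔅)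
          + ∑ P ∈ cfgsIn Q, indZ (qc₁ τ Q P ∈ (Set.univ : Set (Set ι)) ∧ qc₂ τ Q P ∈ (Set.univ : Set (Set ι)) ∧ qc₃ τ Q P ∈ 𝔅 ∩ nonemptyFam)
          - ∑ P ∈ cfgsIn Q, indZ (qc₁ τ Q P ∈ (nonemptyFam : Set (Set ι)) ∧ qc₂ τ Q P ∈ (Set.univ : Set (Set ι)) ∧ qc₃ τ Q P ∈ 𝔅) := by
      rw [← sum_add_distrib, ← sum_sub_distrib]
      refine sum_congr rfl fun P _ => ?_
      unfold cJ
      rw [sub_mul, add_mul, ← indZ_and, ← indZ_and, ← indZ_and]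
      congr 2
      · exact indZ_congr ⟨fun h => ⟨Set.mem_univ _, h.1, h.2.2⟩, fun h => ⟨h.2.1, Set.mem_univ _, h.2.2⟩⟩
      · exact indZ_congr ⟨fun h => ⟨Set.mem_univ _, Set.mem_univ _, h.2.2, h.1⟩, fun h => ⟨h.2.2.2, Set.mem_univ _, h.2.2.1⟩⟩
    rw [elhs, sum_cfgsIn_ind₃_swap12 τ Q (Set.univ : Set (Set ι)) nonemptyFam 𝔅, add_sub_cancel_left]
    have e2 : ∑ P ∈ cfgsIn Q, eJ τ Q nonemptyFam P * indZ (mergeEmptyAt x₀ (qc₃ τ Q P) ∈ (Set.univ : Set (Set ι)) ∧ mergeEmptyAt x₀ (qc₃ τ Q P) ∈ 𝔅)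
        = ∑ P ∈ cfgsIn Q, eJ τ Q nonemptyFam P * indZ (mergeEmptyAt x₀ (qc₃ τ Q P) ∈ 𝔅) :=
      sum_congr rfl fun P _ => by rw [indZ_congr (and_iff_right (Set.mem_univ _))]
    rw [e2]; exact sum_ind_le_sum_eJ_merge (Q := Q) hx₀ h𝔅
  -- generic signatures
  set c : ℤ := indZ (({x₀} : Set ι) ∈ 𝔄 ∧ ({x₀} : Set ι) ∈ 𝔅) with hc
  have elhs : ∀ P ∈ cfgsIn Q, cJ τ Q nonemptyFam P * indZ (qc₂ τ Q P ∈ 𝔄 ∧ qc₃ τ Q P ∈ 𝔅)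
      = indZ (qc₂ τ Q P ∈ 𝔄 ∧ qc₃ τ Q P ∈ 𝔅) + indZ (qc₁ τ Q P = ∅) * indZ (qc₂ τ Q P ∈ 𝔄 ∧ qc₃ τ Q P ∈ 𝔅) := by
    intro P _
    by_cases hI : qc₂ τ Q P ∈ 𝔄 ∧ qc₃ τ Q P ∈ 𝔅
    · have h2 : qc₂ τ Q P ∈ (nonemptyFam : Set (Set ι)) := Set.nonempty_iff_ne_empty.2 fun h => h0A (h ▸ hI.1)
      have h3 : qc₃ τ Q P ∈ (nonemptyFam : Set (Set ι)) := Set.nonempty_iff_ne_empty.2 fun h => h0B (h ▸ hI.2)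
      unfold cJ; rw [indZ_of_pos hI, indZ_of_pos h2, indZ_of_pos h3]
      by_cases h1 : qc₁ τ Q P = ∅
      · rw [indZ_of_pos h1, h1, indZ_of_neg (p := (∅ : Set ι) ∈ (nonemptyFam : Set (Set ι))) Set.not_nonempty_empty]; ring
      · rw [indZ_of_neg h1, indZ_of_pos (p := qc₁ τ Q P ∈ (nonemptyFam : Set (Set ι))) (Set.nonempty_iff_ne_empty.2 h1)]; ring
    · rw [indZ_of_neg hI]; ring
  have erhs : ∀ P ∈ cfgsIn Q, eJ τ Q nonemptyFam P * indZ (mergeEmptyAt x₀ (qc₃ τ Q P) ∈ 𝔄 ∧ mergeEmptyAt x₀ (qc₃ τ Q P) ∈ 𝔅)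
      = indZ (qc₃ τ Q P ∈ 𝔄 ∧ qc₃ τ Q P ∈ 𝔅) + indZ (qc₁ τ Q P = ∅) * indZ (qc₃ τ Q P ∈ 𝔄 ∧ qc₃ τ Q P ∈ 𝔅) - indZ (qc₃ τ Q P = ∅) * c := by
    intro P hP
    unfold eJ
    by_cases h0 : qc₃ τ Q P = ∅
    · have hne := qc₁_nonempty_of_qc₃_empty hT hP h0
      rw [h0, mergeEmptyAt_empty, indZ_of_pos rfl, indZ_of_pos (p := qc₁ τ Q P ∈ (nonemptyFam : Set (Set ι))) hne,
        indZ_of_neg (p := (∅ : Set ι) ∈ (nonemptyFam : Set (Set ι))) Set.not_nonempty_empty,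
        indZ_of_neg (fun h : (∅ : Set ι) ∈ 𝔄 ∧ (∅ : Set ι) ∈ 𝔅 => h0A h.1), indZ_of_neg (Set.nonempty_iff_ne_empty.1 hne), hc]
      ring
    · rw [mergeEmptyAt_of_ne x₀ h0, indZ_of_neg h0, indZ_of_pos (p := qc₃ τ Q P ∈ (nonemptyFam : Set (Set ι))) (Set.nonempty_iff_ne_empty.2 h0)]
      by_cases h1 : qc₁ τ Q P = ∅
      · rw [indZ_of_pos h1, h1, indZ_of_neg (p := (∅ : Set ι) ∈ (nonemptyFam : Set (Set ι))) Set.not_nonempty_empty]; ring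
      · rw [indZ_of_neg h1, indZ_of_pos (p := qc₁ τ Q P ∈ (nonemptyFam : Set (Set ι))) (Set.nonempty_iff_ne_empty.2 h1)]; ring
  rw [sum_congr rfl elhs, sum_congr rfl erhs, sum_add_distrib, sum_sub_distrib, sum_add_distrib, ← sum_mul]
  -- the two fibre identities (weights 1 and [P₁ = T])
  have fib1 := sum_top_sub_two_eq_sum_klCube τ Q 𝔄 𝔅
  have fibT : ∑ P ∈ cfgsIn Q, indZ (qc₁ τ Q P = ∅) * indZ (qc₃ τ Q P ∈ 𝔄 ∧ qc₃ τ Q P ∈ 𝔅)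
      - ∑ P ∈ cfgsIn Q, indZ (qc₁ τ Q P = ∅) * indZ (qc₂ τ Q P ∈ 𝔄 ∧ qc₃ τ Q P ∈ 𝔅)
      = ∑ u ∈ subsetsOf Q, indZ (u = τ ∩ Q) * klCube (shiftFam (τ ∩ Q) u 𝔅) (shiftFam (τ ∩ Q) u 𝔄) (Q \ u) := by
    rw [← sum_sub_distrib, ← sum_top_sub_two_eq_sum_klCube_w τ Q 𝔄 𝔅 (fun u => indZ (u = τ ∩ Q))]
    refine sum_congr rfl fun P _ => ?_
    rw [← mul_sub]
    congr 1
    exact indZ_congr symmDiff_eq_right.symm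
  have hD := sum_indZ_qc₃_empty_eq_card τ Q
  -- the singleton lemma on the fibres avoiding T
  have hsing : ((subsetsOf (Q \ (τ ∩ Q))).card : ℤ) * c ≤ ∑ u ∈ subsetsOf Q, klCube (shiftFam (τ ∩ Q) u 𝔅) (shiftFam (τ ∩ Q) u 𝔄) (Q \ u) := by
    have hsub : subsetsOf (Q \ (τ ∩ Q)) ⊆ subsetsOf Q := fun u hu => mem_subsetsOf.2 ((mem_subsetsOf.1 hu).trans Set.sdiff_subset)
    rw [← sum_sdiff hsub]
    have h1 : 0 ≤ ∑ u ∈ subsetsOf Q \ subsetsOf (Q \ (τ ∩ Q)), klCube (shiftFam (τ ∩ Q) u 𝔅) (shiftFam (τ ∩ Q) u 𝔄) (Q \ u) :=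
      sum_nonneg fun u _ => klCube_nonneg (isUpperSet_shiftFam _ _ h𝔅) (isUpperSet_shiftFam _ _ h𝔄) _
    have h2 : ((subsetsOf (Q \ (τ ∩ Q))).card : ℤ) * c ≤ ∑ u ∈ subsetsOf (Q \ (τ ∩ Q)), klCube (shiftFam (τ ∩ Q) u 𝔅) (shiftFam (τ ∩ Q) u 𝔄) (Q \ u) := by
      have : ∑ _u ∈ subsetsOf (Q \ (τ ∩ Q)), c = (subsetsOf (Q \ (τ ∩ Q))).card * c := by rw [sum_const, nsmul_eq_mul]
      rw [← this]
      refine sum_le_sum fun u hu => ?_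
      rw [mem_subsetsOf] at hu
      have hdis : (τ ∩ Q) ∩ u = ∅ := Set.eq_empty_of_forall_notMem fun y hy => (hu hy.2).2 hy.1
      rw [shiftFam_of_disjoint hdis, shiftFam_of_disjoint hdis]
      by_cases hxAB : ({x₀} : Set ι) ∈ 𝔄 ∧ ({x₀} : Set ι) ∈ 𝔅
      · rw [hc, indZ_of_pos hxAB]
        exact one_le_klCube h𝔅 h𝔄 h0B h0A ⟨hx₀Q, fun hu' => (hu hu').2 hx₀⟩ hxAB.2 hxAB.1
      · rw [hc, indZ_of_neg hxAB]; exact klCube_nonneg h𝔅 h𝔄 _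
    linarith
  have hTfib : 0 ≤ ∑ u ∈ subsetsOf Q, indZ (u = τ ∩ Q) * klCube (shiftFam (τ ∩ Q) u 𝔅) (shiftFam (τ ∩ Q) u 𝔄) (Q \ u) :=
    sum_nonneg fun u _ => mul_nonneg (indZ_nonneg _) (klCube_nonneg (isUpperSet_shiftFam _ _ h𝔅) (isUpperSet_shiftFam _ _ h𝔄) _)
  have fib1' : ∑ P ∈ cfgsIn Q, indZ (qc₃ τ Q P ∈ 𝔄 ∧ qc₃ τ Q P ∈ 𝔅) - ∑ P ∈ cfgsIn Q, indZ (qc₂ τ Q P ∈ 𝔄 ∧ qc₃ τ Q P ∈ 𝔅)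
      = ∑ u ∈ subsetsOf Q, klCube (shiftFam (τ ∩ Q) u 𝔅) (shiftFam (τ ∩ Q) u 𝔄) (Q \ u) := by rw [← sum_sub_distrib]; exact fib1
  rw [hD]
  linarith [fib1', fibT, hsing, hTfib]

/-- **THE TWISTED K* IS A CERTIFICATE**: `DiagCert τ Q nonemptyFam (orKappa τ Q x₀)` for every `x₀ ∈ τ ∩ Q`. [this work] -/
theorem diagCert_orKappa (hx₀ : x₀ ∈ τ ∩ Q) : DiagCert τ Q nonemptyFam (orKappa τ Q x₀) :=
  ⟨fun m _ => orKappa_nonneg τ Q x₀ hx₀ m, fun _ _ h𝔄 h𝔅 => orKappa_two_le hx₀ h𝔄 h𝔅,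
    fun _ _ h𝔄 h𝔅 => orKappa_le_one τ Q x₀ hx₀.2 h𝔄 h𝔅⟩

end TwoLe

end Summit.CriticalPhenomena.PercolationContinuityZ3.Theorems.ThreePartition

end
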